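import Literature.AlgebraicGeometry.Motives.AlbaneseExistenceComplex
import Literature.AlgebraicGeometry.HodgeTheory.AbelianVarietyHodgeHomFullness
import HarnessLib

/-!
# The Albanese pull-back on rational `H¹`: injectivity and the isomorphism criterion in any dimension

Topic `Literature/AlgebraicGeometry/Motives`, sequel of `AlbaneseExistenceComplex` (the Albanese
variety `Motives.Jacobian X` of a smooth projective complex variety of any dimension). PROOF FILE:
theorems only — no definition, no named fact, sorry-free (D-0026).

`AlbaneseExistenceComplex` proves that a morphism `φ : X → A` from a smooth projective complex variety
GENERATING the abelian variety `A` — in particular the Albanese map `f^P : X → Alb X` — is injective on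
`H¹(A(ℂ); ℂ)` (complex coefficients, singular cohomology of the complex points). Consumers that work
with the RATIONAL Betti cohomology `H¹(−(ℂ); ℚ)` and its complexification `ℂ ⊗_ℚ H¹(−(ℂ); ℚ)` (the
tree's `BettiUniverse.pull`, the Hodge structures `BettiUniverse.hodge`, the Picard–CM model universe
of the Hodge-CM cell, whose `pullC` is `(f^* : H¹(ℚ)) ⊗ ℂ`) need the same statement in those two forms;
this file supplies them, by the natural comparison `ℂ ⊗_ℚ Hᵏ(X(ℂ); ℚ) ≅ Hᵏ(X(ℂ); ℂ)`
(`ofRatClassBaseChangeEquiv`, `complexBetti_map_ofRatClassBaseChangeEquiv`) and the faithful flatness of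
`ℂ` over `ℚ` (a `ℚ`-linear retraction `ℂ → ℚ` of the unit):

* `Generates.injective_baseChange_bettiCohomology_map_one` — `(φ^* ⊗ ℂ)` is injective on
  `ℂ ⊗ H¹(A(ℂ); ℚ)`; `Generates.injective_bettiCohomology_map_one` — `φ^*` is injective on `H¹(A(ℂ); ℚ)`;
* `Jacobian.injective_baseChange_bettiCohomology_map_abelJacobi_one_of_dim`,
  `Jacobian.injective_bettiCohomology_map_abelJacobi_one_of_dim` — the same for the Albanese map `f^P`
  of every `𝒥 : Jacobian X`, `X` smooth projective over `ℂ` of any dimension (the curve case, by the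
  finite index of `(f^P)_* π₁`, is `Jacobian.injective_bettiCohomology_map_abelJacobi_of_index_ne_zero`);
* `Jacobian.isIso_bettiCohomology_map_abelJacobi_of_finrank_le_of_dim` and
  `Jacobian.isIso_bettiCohomology_map_abelJacobi_iff_finrank_le_of_dim` — **the Albanese criterion in
  any dimension, sharp form**: `(f^P)^* : H¹(J(ℂ); ℚ) → H¹(X(ℂ); ℚ)` is an isomorphism iff
  `b₁(X(ℂ)) ≤ 2 dim J` (the general-dimension twin of
  `Jacobian.isIso_bettiCohomology_map_abelJacobi_of_finrank_le_two_mul_dim`, `d = 1`).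

In print: Bădescu, *Algebraic Surfaces*, Thm. 5.3 (`dim Alb(X) ≤ q`, with equality in characteristic
`0`); Voisin I, Lemma 7.28 (injectivity of pull-back along surjective maps) and Thm. 12.15 (the Albanese
torus); Liu 2021, Lemma 2.4 (1) (`H¹(Alb X, ℚ) ≅ H¹(X, ℚ)` via `α^*` — the statement whose "easy half"
is proved here and whose other half is the inequality `b₁(X) ≤ 2 dim Alb X`).

## References

* [Badescu2001] L. Bădescu, *Algebraic Surfaces* (2001), Ch. 5 Def. 5.2, Thm. 5.3.
* [Voisin2002] C. Voisin, *Hodge Theory and Complex Algebraic Geometry I* (2002), Lemma 7.28, Thm. 12.15.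
* [Liu2021] Y. Liu, *Fourier–Jacobi cycles and arithmetic relative trace formula*, Camb. J. Math. 9
  (2021), Lemma 2.4 (1).
* [HatcherAT2002] A. Hatcher, *Algebraic Topology* (2002), §3.1 Thm. 3.2, §3.A Cor. 3A.6 (universal
  coefficients over a field).
-/

noncomputable section

open CategoryTheory AlgebraicGeometry
open scoped TensorProduct

namespace Literature.AlgebraicGeometry.Motives

open Literature.AlgebraicGeometry.HodgeTheory

universe u

/-! ### §0 Faithful flatness of `ℂ/ℚ` on injectivity -/

section Flat

variable {V W : Type*} [AddCommGroup V] [Module ℚ V] [AddCommGroup W] [Module ℚ W]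

/-- `v ↦ 1 ⊗ v : W → ℂ ⊗_ℚ W` is injective (a `ℚ`-linear retraction `r : ℂ → ℚ` of the unit gives
the retraction `r ⊗ W`). [folklore] -/
private theorem tmul_one_injective : Function.Injective (fun w : W => (1 : ℂ) ⊗ₜ[ℚ] w) := by
  have hker : LinearMap.ker (Algebra.linearMap ℚ ℂ) = ⊥ :=
    LinearMap.ker_eq_bot.mpr (algebraMap ℚ ℂ).injective
  obtain ⟨r, hr⟩ := (Algebra.linearMap ℚ ℂ).exists_leftInverse_of_injective hker
  have hr1 : r 1 = 1 := by
    have := LinearMap.congr_fun hr (1 : ℚ)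
    simpa using this
  intro w w' h
  have h' := congrArg ((TensorProduct.lid ℚ W).toLinearMap ∘ₗ r.rTensor W) h
  simpa [LinearMap.rTensor_tmul, hr1] using h'

/-- A `ℚ`-linear map whose complexification is injective is injective. [folklore] -/
private theorem injective_of_injective_baseChange {f : V →ₗ[ℚ] W}
    (h : Function.Injective (f.baseChange ℂ)) : Function.Injective f := by
  intro v v' hvv'
  have h1 : f.baseChange ℂ ((1 : ℂ) ⊗ₜ v) = f.baseChange ℂ ((1 : ℂ) ⊗ₜ v') := by
    rw [LinearMap.baseChange_tmul, LinearMap.baseChange_tmul, hvv']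
  exact tmul_one_injective (h h1)

end Flat

/-! ### §1 Surjective morphisms and generating morphisms: rational coefficients -/

section Surjective

variable {c w k : ℕ} {F W : SchemeOver ℂ}

/-- **Voisin I Lemma 7.28 on `ℂ ⊗_ℚ Hᵏ(−(ℂ); ℚ)`**: for a SURJECTIVE morphism `f : W → F` of smooth
projective complex varieties, `f^* ⊗ ℂ` is injective (the tree's `complexBetti_map_injective_of_surjective`
read through the comparison `ℂ ⊗_ℚ Hᵏ(−; ℚ) ≅ Hᵏ(−; ℂ)`). [cite: Voisin2002, Lemma 7.28] [cite: HatcherAT2002, §3.A Cor. 3A.6] -/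
theorem injective_baseChange_bettiCohomology_map_of_surjective (hF : IsSmoothProjective c F)
    (hW : IsSmoothProjective w W) (f : W ⟶ F) [Surjective f.left] (k : ℕ) :
    Function.Injective ((bettiCohomology.map f k).hom.baseChange ℂ) := by
  have hinj := complexBetti_map_injective_of_surjective hF hW f k
  intro t t' htt'
  have h := congrArg (ofRatClassBaseChangeEquiv hW k) htt'
  rw [← complexBetti_map_ofRatClassBaseChangeEquiv hW hF f t,
    ← complexBetti_map_ofRatClassBaseChangeEquiv hW hF f t'] at h
  exact (ofRatClassBaseChangeEquiv hF k).injective (hinj h)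

/-- **Voisin I Lemma 7.28 with rational coefficients**: for a surjective morphism `f : W → F` of smooth
projective complex varieties, `f^* : Hᵏ(F(ℂ); ℚ) → Hᵏ(W(ℂ); ℚ)` is injective.
[cite: Voisin2002, Lemma 7.28] [cite: HatcherAT2002, §3.A Cor. 3A.6] -/
theorem injective_bettiCohomology_map_of_surjective (hF : IsSmoothProjective c F)
    (hW : IsSmoothProjective w W) (f : W ⟶ F) [Surjective f.left] (k : ℕ) :
    Function.Injective (bettiCohomology.map f k) :=
  injective_of_injective_baseChange (injective_baseChange_bettiCohomology_map_of_surjective hF hW f k)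

/-- **A surjective homomorphism of complex abelian varieties is injective on `ℂ ⊗_ℚ H¹`.**
[cite: Voisin2002, Lemma 7.28] -/
theorem AbelianVariety.injective_baseChange_bettiCohomology_map_one_of_surjective {A B : AbelianVariety ℂ}
    (u : A ⟶ B) [Surjective (AbelianVariety.Hom.toSchemeHom u)] :
    Function.Injective ((bettiCohomology.map u.hom.hom.hom 1).hom.baseChange ℂ) :=
  injective_baseChange_bettiCohomology_map_of_surjective (AbelianVariety.isSmoothProjective_holds (A := B))
    (AbelianVariety.isSmoothProjective_holds (A := A)) u.hom.hom.hom 1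

end Surjective

section Generates

variable {d : ℕ} {X : SchemeOver ℂ} {A : AbelianVariety ℂ} {φ : X ⟶ A.X}

/-- **`φ^* ⊗ ℂ` is injective on `ℂ ⊗_ℚ H¹(A(ℂ); ℚ)`** for a morphism `φ : X → A` from a smooth
projective complex variety generating the abelian variety `A`: under the natural comparison
`ℂ ⊗_ℚ H¹(−(ℂ); ℚ) ≅ H¹(−(ℂ); ℂ)` (`complexBetti_map_ofRatClassBaseChangeEquiv`) this is
`Generates.injective_complexBetti_map_one`. [cite: Voisin2002, Lemma 7.28] [cite: HatcherAT2002, §3.A Cor. 3A.6] -/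
theorem Generates.injective_baseChange_bettiCohomology_map_one (hX : IsSmoothProjective d X)
    (hφ : Generates φ) :
    Function.Injective ((bettiCohomology.map φ 1).hom.baseChange ℂ) := by
  have hA : IsSmoothProjective A.dim A.X := AbelianVariety.isSmoothProjective_holds
  have hinj := hφ.injective_complexBetti_map_one hX
  intro t t' htt'
  have h := congrArg (ofRatClassBaseChangeEquiv hX 1) htt'
  rw [← complexBetti_map_ofRatClassBaseChangeEquiv hX hA φ t,
    ← complexBetti_map_ofRatClassBaseChangeEquiv hX hA φ t'] at h
  exact (ofRatClassBaseChangeEquiv hA 1).injective (hinj h)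

/-- **`φ^*` is injective on `H¹(A(ℂ); ℚ)`** for a morphism `φ : X → A` from a smooth projective complex
variety generating the abelian variety `A` (from the complexified statement, `ℂ` being faithfully flat
over `ℚ`). [cite: Voisin2002, Lemma 7.28] [cite: HatcherAT2002, §3.A Cor. 3A.6] -/
theorem Generates.injective_bettiCohomology_map_one (hX : IsSmoothProjective d X) (hφ : Generates φ) :
    Function.Injective (bettiCohomology.map φ 1) :=
  injective_of_injective_baseChange (hφ.injective_baseChange_bettiCohomology_map_one hX)

end Generates

/-! ### §2 The Albanese pull-back on rational `H¹` -/

namespace Jacobian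

variable {d : ℕ} {X : SchemeOver ℂ}

/-- **`(f^P)^* ⊗ ℂ` is injective on `ℂ ⊗_ℚ H¹(J(ℂ); ℚ)`** for every Albanese datum `𝒥 : Jacobian X` of a
smooth projective complex variety of any dimension and every `P ∈ X(ℂ)` (`f^P` generates `J`,
`generates_abelJacobi`). [cite: Badescu2001, Ch. 5 Thm. 5.3] [cite: Voisin2002, Lemma 7.28] -/
theorem injective_baseChange_bettiCohomology_map_abelJacobi_one_of_dim (hX : IsSmoothProjective d X)
    (𝒥 : Jacobian X) (P : AlgPoints X ℂ) :
    Function.Injective ((bettiCohomology.map (𝒥.abelJacobi P) 1).hom.baseChange ℂ) :=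
  haveI := IsSmoothProjective.isProper_holds hX
  haveI := IsSmoothProjective.geometricallyIntegral_holds hX
  (𝒥.generates_abelJacobi P).injective_baseChange_bettiCohomology_map_one hX

/-- **`(f^P)^* : H¹(J(ℂ); ℚ) → H¹(X(ℂ); ℚ)` is injective** for every Albanese datum of a smooth
projective complex variety of any dimension (Liu 2021 Lemma 2.4 (1), injectivity half; the curve case is
`injective_bettiCohomology_map_abelJacobi_of_index_ne_zero` with `index_range_map_abelJacobi_ne_zero`).
[cite: Liu2021, Lemma 2.4 (1)] [cite: Badescu2001, Ch. 5 Thm. 5.3] [cite: Voisin2002, Lemma 7.28] -/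
theorem injective_bettiCohomology_map_abelJacobi_one_of_dim (hX : IsSmoothProjective d X)
    (𝒥 : Jacobian X) (P : AlgPoints X ℂ) :
    Function.Injective (bettiCohomology.map (𝒥.abelJacobi P) 1) :=
  injective_of_injective_baseChange
    (𝒥.injective_baseChange_bettiCohomology_map_abelJacobi_one_of_dim hX P)

/-- `b₁(J(ℂ)) ≤ b₁(X(ℂ))` for every Albanese datum of a smooth projective complex variety.
[cite: Badescu2001, Ch. 5 Thm. 5.3] -/
theorem finrank_bettiCohomology_le_of_dim (hX : IsSmoothProjective d X) (𝒥 : Jacobian X) :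
    Module.finrank ℚ (bettiCohomology 𝒥.J.X 1) ≤ Module.finrank ℚ (bettiCohomology X 1) := by
  rw [𝒥.J.finrank_bettiCohomology_one_eq_two_mul_dim]
  exact two_mul_dim_le_finrank_bettiCohomology_of_dim hX 𝒥

/-- **The Albanese criterion in any dimension (sharp form).** For an Albanese datum `𝒥` of a smooth
projective complex variety `X` and `P ∈ X(ℂ)`, `(f^P)^* : H¹(J(ℂ); ℚ) → H¹(X(ℂ); ℚ)` is an isomorphism
as soon as `b₁(X(ℂ)) ≤ 2 dim J`: it is injective (`injective_bettiCohomology_map_abelJacobi_one_of_dim`)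
between spaces of the same finite dimension (`b₁(J) = 2 dim J ≤ b₁(X) ≤ 2 dim J`). The hypothesis is
the transcendental half of Bădescu Thm. 5.3 / Voisin I Thm. 12.15 / Liu 2021 Lemma 2.4 (1)
(`dim Alb X = q = ½ b₁`), NOT proved in the tree in dimension `≥ 2`.
[cite: Liu2021, Lemma 2.4 (1)] [cite: Voisin2002, Thm. 12.15] [cite: Badescu2001, Ch. 5 Thm. 5.3] -/
theorem isIso_bettiCohomology_map_abelJacobi_of_finrank_le_of_dim (hX : IsSmoothProjective d X)
    (𝒥 : Jacobian X) (P : AlgPoints X ℂ)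
    (h : Module.finrank ℚ (bettiCohomology X 1) ≤ 2 * 𝒥.J.dim) :
    IsIso (bettiCohomology.map (𝒥.abelJacobi P) 1) := by
  haveI := finite_bettiCohomology_of_isSmoothProjective hX 1
  have hinj := 𝒥.injective_bettiCohomology_map_abelJacobi_one_of_dim hX P
  have heq : Module.finrank ℚ (bettiCohomology 𝒥.J.X 1) = Module.finrank ℚ (bettiCohomology X 1) := by
    rw [𝒥.J.finrank_bettiCohomology_one_eq_two_mul_dim]
    exact two_mul_dim_eq_finrank_bettiCohomology_of_finrank_le_of_dim hX 𝒥 h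
  have hbij : Function.Bijective (bettiCohomology.map (𝒥.abelJacobi P) 1) :=
    ⟨hinj, (LinearMap.injective_iff_surjective_of_finrank_eq_finrank heq).mp hinj⟩
  exact (ConcreteCategory.isIso_iff_bijective _).mpr hbij

/-- **`(f^P)^*` is an isomorphism on `H¹(−; ℚ)` iff `b₁(X(ℂ)) ≤ 2 dim J`** (the converse direction: an
isomorphism identifies the dimensions, `b₁(J) = 2 dim J`). [cite: Liu2021, Lemma 2.4 (1)]
[cite: Badescu2001, Ch. 5 Thm. 5.3] -/
theorem isIso_bettiCohomology_map_abelJacobi_iff_finrank_le_of_dim (hX : IsSmoothProjective d X)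
    (𝒥 : Jacobian X) (P : AlgPoints X ℂ) :
    IsIso (bettiCohomology.map (𝒥.abelJacobi P) 1) ↔
      Module.finrank ℚ (bettiCohomology X 1) ≤ 2 * 𝒥.J.dim := by
  refine ⟨fun hI => ?_, 𝒥.isIso_bettiCohomology_map_abelJacobi_of_finrank_le_of_dim hX P⟩
  rw [← 𝒥.J.finrank_bettiCohomology_one_eq_two_mul_dim]
  exact (LinearEquiv.finrank_eq (asIso (bettiCohomology.map (𝒥.abelJacobi P) 1)).toLinearEquiv).ge

/-- **`(f^P)^* ⊗ ℂ` is bijective on `ℂ ⊗_ℚ H¹` as soon as `b₁(X(ℂ)) ≤ 2 dim J`** (base change of the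
rational isomorphism). [cite: Liu2021, Lemma 2.4 (1)] [cite: Voisin2002, Thm. 12.15] -/
theorem bijective_baseChange_bettiCohomology_map_abelJacobi_of_finrank_le_of_dim
    (hX : IsSmoothProjective d X) (𝒥 : Jacobian X) (P : AlgPoints X ℂ)
    (h : Module.finrank ℚ (bettiCohomology X 1) ≤ 2 * 𝒥.J.dim) :
    Function.Bijective ((bettiCohomology.map (𝒥.abelJacobi P) 1).hom.baseChange ℂ) := by
  haveI := 𝒥.isIso_bettiCohomology_map_abelJacobi_of_finrank_le_of_dim hX P h
  let e : bettiCohomology 𝒥.J.X 1 ≃ₗ[ℚ] bettiCohomology X 1 :=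
    (asIso (bettiCohomology.map (𝒥.abelJacobi P) 1)).toLinearEquiv
  have he : (bettiCohomology.map (𝒥.abelJacobi P) 1).hom.baseChange ℂ = (e.baseChange ℚ ℂ _ _).toLinearMap := by
    rw [LinearEquiv.coe_baseChange]
    rfl
  rw [he]
  exact (e.baseChange ℚ ℂ _ _).bijective

end Jacobian

end Literature.AlgebraicGeometry.Motives

end
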